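import Mathlib
import HarnessLib
import Summits.PneNP.PneNP.Theorems.AeaCutRectanglesToftSystem

/-!
# Route AeaCutRectangles — D1 and the fixed-cut fooling measure of the Toft system; transport
# (file 3 of 4 of the BC5 rung of the deciding crux `FoolingMeasure`, stmt-PneNP-19727)

**D1** (`toft_D1`): every transversal graph `frame L ∪ range t` of `𝒯_L` is NOT 3-colourable (a 3-colouring
would make the diamonds identify `bᵢ ~ b'ᵢ`, `cⱼ ~ c'ⱼ`, the matchings and the `L²` chosen unit edges then force
Toft's 4-chromatic pattern odd cycle / matching / `K_(L,L)` / matching / odd cycle — contradiction via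
`odd_cycle`).  With D2 (file 2) and the transversal engine (file 1): `toft_fooling` — `mu (frame L) (unit L)` is
a probability measure on loopless NON-3-COLOURABLE edge sets and every cut rectangle over `cut L` inside
NON-3-COL has mass `≤ (1/2)^(L·L)`.  `transport` moves such a fixed-cut fooling package along any vertex
bijection `V ≃ W` (used in file 4 with `finProdFinEquiv : Fin 10 × Fin L ≃ Fin (10 L)`); the pull-back of edge
sets is built inline from `Sym2.map`, no new definitions.

HONEST FRAMING: elementary finite combinatorics (Toft 1970-type critical graphs, a hybrid/fooling argument,
bookkeeping of an explicit measure); FRONTIER material for a rung of Fagin's complement ladder (NON-3-COL vs.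
ESO(∀∃∀, arity 2)); nothing here bears on P vs NP, and the summit stays where it was.

Sources: programme archive 2001, pnp/generalized-spectra-complement/work/aea/AEA.md Def. 4.1, Thm. 4.2, Prop. 5.1,
§6; blind-check records bc-aea-rectangles (B)(D), bc-aea-cut37; B. Toft, "On the maximal number of edges of
critical k-chromatic graphs", Studia Sci. Math. Hungar. 5 (1970) 461–470 (the dense 4-critical graphs).
-/

set_option linter.dupNamespace false -- `Summit.PneNP.PneNP.…`: summit = sub-problem name (D-0017 single-conjunct layout)

namespace Summit.PneNP.PneNP.Theorems.AeaCutRectanglesFixedCutFooling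

open Finset
open Summit.PneNP.PneNP.Theorems.AeaCutRectanglesTransversalEngine

/-! ### D1 — every transversal graph of `𝒯_L` is NOT 3-colourable -/

section framefacts
variable {L : ℕ} (i : Fin L)

/-- The `A`-cycle edges lie in the frame. -/
theorem memA : s(vx 0 i, vx 0 (succMod i)) ∈ frame L := by
  simp only [frame, mem_union, mem_image, mem_univ, true_and]
  exact Or.inl (Or.inl (Or.inl (Or.inl (Or.inl ⟨i, rfl⟩))))
/-- The `D`-cycle edges lie in the frame. -/
theorem memD : s(vx 1 i, vx 1 (succMod i)) ∈ frame L := by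
  simp only [frame, mem_union, mem_image, mem_univ, true_and]
  exact Or.inl (Or.inl (Or.inl (Or.inl (Or.inr ⟨i, rfl⟩))))
/-- Frame membership (matching `a b`). -/
theorem memAB : s(vx 0 i, vx 2 i) ∈ frame L := by simp [frame]
/-- Frame membership (matching `d c`). -/
theorem memDC : s(vx 1 i, vx 6 i) ∈ frame L := by simp [frame]
/-- Frame membership (diamond edge between blocks 2 and 4). -/
theorem mem24 : s(vx 2 i, vx 4 i) ∈ frame L := by simp [frame]
/-- Frame membership (diamond edge between blocks 2 and 5). -/
theorem mem25 : s(vx 2 i, vx 5 i) ∈ frame L := by simp [frame]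
/-- Frame membership (diamond edge between blocks 3 and 4). -/
theorem mem34 : s(vx 3 i, vx 4 i) ∈ frame L := by simp [frame]
/-- Frame membership (diamond edge between blocks 3 and 5). -/
theorem mem35 : s(vx 3 i, vx 5 i) ∈ frame L := by simp [frame]
/-- Frame membership (diamond edge between blocks 4 and 5). -/
theorem mem45 : s(vx 4 i, vx 5 i) ∈ frame L := by simp [frame]
/-- Frame membership (diamond edge between blocks 6 and 8). -/
theorem mem68 : s(vx 6 i, vx 8 i) ∈ frame L := by simp [frame]
/-- Frame membership (diamond edge between blocks 6 and 9). -/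
theorem mem69 : s(vx 6 i, vx 9 i) ∈ frame L := by simp [frame]
/-- Frame membership (diamond edge between blocks 7 and 8). -/
theorem mem78 : s(vx 7 i, vx 8 i) ∈ frame L := by simp [frame]
/-- Frame membership (diamond edge between blocks 7 and 9). -/
theorem mem79 : s(vx 7 i, vx 9 i) ∈ frame L := by simp [frame]
/-- Frame membership (diamond edge between blocks 8 and 9). -/
theorem mem89 : s(vx 8 i, vx 9 i) ∈ frame L := by simp [frame]

end framefacts

/-- **D1 for `𝒯_L`**: Toft's graph is 4-chromatic, hence so is every transversal graph. -/
theorem toft_D1 {L : ℕ} (hL : Odd L) (h3 : 3 ≤ L) (t : Fin L × Fin L → Sym2 (Vx L))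
    (ht : ∀ u, t u ∈ unit L u) :
    ¬ (SimpleGraph.fromEdgeSet (↑(tg (frame L) t) : Set (Sym2 (Vx L)))).Colorable 3 := by
  rintro ⟨κ⟩
  have adj : ∀ a b : Vx L, s(a, b) ∈ tg (frame L) t → a ≠ b → κ a ≠ κ b := fun a b h hne =>
    κ.valid (by rw [SimpleGraph.fromEdgeSet_adj, Finset.mem_coe]; exact ⟨h, hne⟩)
  have fr : ∀ a b : Vx L, s(a, b) ∈ frame L → a ≠ b → κ a ≠ κ b := fun a b h =>
    adj a b (mem_tg.2 (Or.inl h))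
  have hsucc : ∀ i : Fin L, succMod i ≠ i := succMod_ne_self (by omega)
  have h0L : 0 < L := by omega
  set i0 : Fin L := ⟨0, h0L⟩
  -- diamonds: col b = col b', col c = col c'
  have eqb : ∀ i, κ (vx 2 i) = κ (vx 3 i) := fun i => by
    rcases fin3_diamond_cases (κ (vx 2 i)) (κ (vx 3 i)) (κ (vx 4 i)) (κ (vx 5 i)) with h | h | h | h | h | h
    · exact (fr _ _ (mem45 i) (by simp) h).elim
    · exact (fr _ _ (mem24 i) (by simp) h).elim
    · exact (fr _ _ (mem25 i) (by simp) h).elim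
    · exact (fr _ _ (mem34 i) (by simp) h).elim
    · exact (fr _ _ (mem35 i) (by simp) h).elim
    · exact h
  have eqc : ∀ j, κ (vx 6 j) = κ (vx 7 j) := fun j => by
    rcases fin3_diamond_cases (κ (vx 6 j)) (κ (vx 7 j)) (κ (vx 8 j)) (κ (vx 9 j)) with h | h | h | h | h | h
    · exact (fr _ _ (mem89 j) (by simp) h).elim
    · exact (fr _ _ (mem68 j) (by simp) h).elim
    · exact (fr _ _ (mem69 j) (by simp) h).elim
    · exact (fr _ _ (mem78 j) (by simp) h).elim
    · exact (fr _ _ (mem79 j) (by simp) h).elim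
    · exact h
  -- units: col bᵢ ≠ col cⱼ
  have bc : ∀ i j, κ (vx 2 i) ≠ κ (vx 6 j) := fun i j => by
    have hu := ht (i, j)
    rw [mem_unit] at hu
    rcases hu with hu | hu
    · exact adj _ _ (mem_tg.2 (Or.inr ⟨(i, j), hu⟩)) (by simp)
    · rw [eqb, eqc]
      exact adj _ _ (mem_tg.2 (Or.inr ⟨(i, j), hu⟩)) (by simp)
  by_cases hC : ∃ j j', κ (vx 6 j) ≠ κ (vx 6 j')
  · -- C uses two colours ⇒ B is monochromatic ⇒ the A-cycle avoids that colour
    obtain ⟨j, j', hjj⟩ := hC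
    have hB : ∀ i, κ (vx 2 i) = κ (vx 2 i0) := fun i => by
      rcases fin3_third_cases (κ (vx 2 i0)) (κ (vx 6 j)) (κ (vx 6 j')) (κ (vx 2 i))
        with h | h | h | h | h | h
      · exact (bc _ _ h).elim
      · exact (bc _ _ h).elim
      · exact (hjj h).elim
      · exact (bc _ _ h).elim
      · exact (bc _ _ h).elim
      · exact h
    exact odd_cycle hL (fun i => κ (vx 0 i)) (κ (vx 2 i0))
      (fun i => by rw [← hB i]; exact fr _ _ (memAB i) (by simp))
      (fun i => fr _ _ (memA i) (by simpa using (hsucc i).symm))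
  · -- C is monochromatic ⇒ the D-cycle avoids that colour
    have hC' : ∀ j j', κ (vx 6 j) = κ (vx 6 j') := fun j j' => by
      by_contra h
      exact hC ⟨j, j', h⟩
    exact odd_cycle hL (fun j => κ (vx 1 j)) (κ (vx 6 i0))
      (fun j => by rw [hC' i0 j]; exact fr _ _ (memDC j) (by simp))
      (fun j => fr _ _ (memD j) (by simpa using (hsucc j).symm))

/-! ### The fixed-cut fooling measure of `𝒯_L` -/

/-- The frame is loopless (`L ≥ 3`, so the cycles have no loops). -/
theorem frame_loopless {L : ℕ} (h3 : 3 ≤ L) : ∀ e ∈ frame L, ¬ e.IsDiag := by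
  intro e he
  have hsucc : ∀ i : Fin L, succMod i ≠ i := succMod_ne_self (by omega)
  simp only [frame, mem_union, mem_image, mem_biUnion, mem_univ, true_and, mem_insert, mem_singleton] at he
  rcases he with ((((⟨i, rfl⟩ | ⟨i, rfl⟩) | ⟨i, rfl⟩) | ⟨i, rfl⟩) | ⟨i, h | h | h | h | h⟩) | ⟨i, h | h | h | h | h⟩
  all_goals first | subst h | skip
  all_goals rw [Sym2.mk_isDiag_iff, vx_inj]
  all_goals first | exact fun h => hsucc i h.2.symm | simp

/-- Transversal graphs of `𝒯_L` are loopless. -/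
theorem tg_loopless {L : ℕ} (h3 : 3 ≤ L) (t : Fin L × Fin L → Sym2 (Vx L)) (ht : ∀ u, t u ∈ unit L u) :
    ∀ e ∈ tg (frame L) t, ¬ e.IsDiag := by
  intro e he
  rcases mem_tg.1 he with he | ⟨u, rfl⟩
  · exact frame_loopless h3 e he
  · have hu := ht u
    rw [mem_unit] at hu
    rcases hu with hu | hu <;> rw [hu, Sym2.mk_isDiag_iff] <;> simp

/-- **The fixed-cut fooling measure on `𝒯_L`** (AEA.md Prop. 5.1 at the cut `B₀`): `mu (frame L) (unit L)` is a
probability measure on loopless non-3-colourable edge sets, `|B₀| = 5L`, and every cut rectangle over `B₀`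
inside NON-3-COL has mass `≤ (1/2)^{L·L}`. -/
theorem toft_fooling {L : ℕ} (hL : Odd L) (h3 : 3 ≤ L) :
    (∀ S, 0 ≤ mu (frame L) (unit L) S) ∧ (∑ S, mu (frame L) (unit L) S = 1) ∧
    (∀ S, mu (frame L) (unit L) S ≠ 0 →
      (∀ e ∈ S, ¬ e.IsDiag) ∧ ¬ (SimpleGraph.fromEdgeSet (S : Set (Sym2 (Vx L)))).Colorable 3) ∧
    (cut L).card = 5 * L ∧
    ∀ 𝓐 𝓑 : Finset (Finset (Sym2 (Vx L))),
      (∀ α ∈ 𝓐, ∀ e ∈ α, ¬ e.IsDiag ∧ ∃ v ∈ e, v ∉ cut L) →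
      (∀ β ∈ 𝓑, ∀ e ∈ β, ¬ e.IsDiag ∧ ∀ v ∈ e, v ∈ cut L) →
      (∀ α ∈ 𝓐, ∀ β ∈ 𝓑,
        ¬ (SimpleGraph.fromEdgeSet ((α ∪ β : Finset (Sym2 (Vx L))) : Set (Sym2 (Vx L)))).Colorable 3) →
      ∑ q ∈ 𝓐 ×ˢ 𝓑, mu (frame L) (unit L) (q.1 ∪ q.2) ≤ (1 / 2 : ℝ) ^ (L * L) := by
  refine ⟨mu_nonneg _ _, mu_sum _ fun u => card_pos.1 (by rw [unit_card]; exact Nat.succ_pos 1), ?_,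
    cut_card L, ?_⟩
  · intro S hS
    obtain ⟨t, ht, rfl⟩ := mu_support hS
    exact ⟨tg_loopless h3 t ht, toft_D1 hL h3 t ht⟩
  · intro 𝓐 𝓑 h𝓐 h𝓑 hN
    have h := rect_mass_le_half_pow (fun u => unit_card u) (toft_D2 hL h3) (univ : Finset (Fin L × Fin L))
      ?_ 𝓐 𝓑 h𝓐 h𝓑 hN
    · simpa [Finset.card_univ, Fintype.card_prod, Fintype.card_fin] using h
    · intro u _
      refine ⟨⟨s(vx 3 u.1, vx 7 u.2), by simp [unit], ?_⟩, ⟨s(vx 2 u.1, vx 6 u.2), by simp [unit], vx 2 u.1,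
        by simp, by simp [mem_cut]⟩⟩
      intro v hv
      rw [Sym2.mem_iff] at hv
      rcases hv with rfl | rfl <;> simp [mem_cut]

/-! ### Transport of a fixed-cut fooling package along a vertex bijection -/

section transport

variable {V W : Type*}

/-- Round trip of `Sym2.map` along a bijection. -/
theorem map_map_symm (e : V ≃ W) (z : Sym2 W) : Sym2.map e (Sym2.map e.symm z) = z := by
  induction z using Sym2.ind
  simp [Sym2.map_mk]

/-- Round trip of `Sym2.map` along a bijection (other direction). -/
theorem map_symm_map (e : V ≃ W) (z : Sym2 V) : Sym2.map e.symm (Sym2.map e z) = z := by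
  induction z using Sym2.ind
  simp [Sym2.map_mk]

/-- `Sym2.map` along a bijection preserves being a loop. -/
theorem isDiag_map_iff (e : V ≃ W) (z : Sym2 V) : (Sym2.map e z).IsDiag ↔ z.IsDiag := by
  induction z using Sym2.ind
  simp [Sym2.map_mk, Sym2.mk_isDiag_iff, e.injective.eq_iff]

/-- A pull-back `P` of edge sets along `e` (given by its membership law) commutes with unions. -/
theorem pull_union [DecidableEq V] [DecidableEq W] (e : V ≃ W) {P : Finset (Sym2 W) → Finset (Sym2 V)}
    (hP : ∀ S z, z ∈ P S ↔ Sym2.map e z ∈ S) (S T : Finset (Sym2 W)) : P (S ∪ T) = P S ∪ P T := by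
  ext z
  rw [Finset.mem_union, hP, hP, hP, Finset.mem_union]

/-- Colourability is invariant under pulling an edge set back along a bijection. -/
theorem colorable_pull_iff (e : V ≃ W) {P : Finset (Sym2 W) → Finset (Sym2 V)}
    (hP : ∀ S z, z ∈ P S ↔ Sym2.map e z ∈ S) (S : Finset (Sym2 W)) (n : ℕ) :
    (SimpleGraph.fromEdgeSet (↑(P S) : Set (Sym2 V))).Colorable n ↔
      (SimpleGraph.fromEdgeSet (↑S : Set (Sym2 W))).Colorable n := by
  have hmk : ∀ v w : V, s(v, w) ∈ P S ↔ s(e v, e w) ∈ S := fun v w => by rw [hP, Sym2.map_mk]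
  constructor
  · rintro ⟨κ⟩
    refine ⟨SimpleGraph.Coloring.mk (fun w => κ (e.symm w)) ?_⟩
    intro a b hab
    rw [SimpleGraph.fromEdgeSet_adj, Finset.mem_coe] at hab
    apply κ.valid
    rw [SimpleGraph.fromEdgeSet_adj, Finset.mem_coe, hmk, Equiv.apply_symm_apply,
      Equiv.apply_symm_apply]
    exact ⟨hab.1, fun h => hab.2 (e.symm.injective h)⟩
  · rintro ⟨κ⟩
    refine ⟨SimpleGraph.Coloring.mk (fun v => κ (e v)) ?_⟩
    intro a b hab
    rw [SimpleGraph.fromEdgeSet_adj, Finset.mem_coe, hmk] at hab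
    apply κ.valid
    rw [SimpleGraph.fromEdgeSet_adj, Finset.mem_coe]
    exact ⟨hab.1, fun h => hab.2 (e.injective h)⟩

/-- **Transport**: a fixed-cut fooling package (probability measure on loopless non-3-colourable edge sets with
a cut `B` and a uniform bound for cut rectangles over `B` inside NON-3-COL) moves along any vertex bijection
`e : V ≃ W`, with cut `B.map e`.  The pull-back bijection of edge sets is built inline from `Sym2.map`. -/
theorem transport [Fintype V] [DecidableEq V] [Fintype W] [DecidableEq W] (e : V ≃ W)
    (μ : Finset (Sym2 V) → ℝ) (B : Finset V) (bound : ℝ)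
    (h0 : ∀ S, 0 ≤ μ S) (h1 : ∑ S, μ S = 1)
    (hs : ∀ S, μ S ≠ 0 →
      (∀ z ∈ S, ¬ z.IsDiag) ∧ ¬ (SimpleGraph.fromEdgeSet (S : Set (Sym2 V))).Colorable 3)
    (hr : ∀ 𝓐 𝓑 : Finset (Finset (Sym2 V)),
      (∀ α ∈ 𝓐, ∀ z ∈ α, ¬ z.IsDiag ∧ ∃ v ∈ z, v ∉ B) →
      (∀ β ∈ 𝓑, ∀ z ∈ β, ¬ z.IsDiag ∧ ∀ v ∈ z, v ∈ B) →
      (∀ α ∈ 𝓐, ∀ β ∈ 𝓑,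
        ¬ (SimpleGraph.fromEdgeSet ((α ∪ β : Finset (Sym2 V)) : Set (Sym2 V))).Colorable 3) →
      ∑ q ∈ 𝓐 ×ˢ 𝓑, μ (q.1 ∪ q.2) ≤ bound) :
    ∃ μ' : Finset (Sym2 W) → ℝ, (∀ S, 0 ≤ μ' S) ∧ (∑ S, μ' S = 1) ∧
      (∀ S, μ' S ≠ 0 →
        (∀ z ∈ S, ¬ z.IsDiag) ∧ ¬ (SimpleGraph.fromEdgeSet (S : Set (Sym2 W))).Colorable 3) ∧
      ∀ 𝓐 𝓑 : Finset (Finset (Sym2 W)),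
        (∀ α ∈ 𝓐, ∀ z ∈ α, ¬ z.IsDiag ∧ ∃ v ∈ z, v ∉ B.map e.toEmbedding) →
        (∀ β ∈ 𝓑, ∀ z ∈ β, ¬ z.IsDiag ∧ ∀ v ∈ z, v ∈ B.map e.toEmbedding) →
        (∀ α ∈ 𝓐, ∀ β ∈ 𝓑,
          ¬ (SimpleGraph.fromEdgeSet ((α ∪ β : Finset (Sym2 W)) : Set (Sym2 W))).Colorable 3) →
        ∑ q ∈ 𝓐 ×ˢ 𝓑, μ' (q.1 ∪ q.2) ≤ bound := by
  -- the pull-back bijection of edge sets, with its membership law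
  obtain ⟨P, hP⟩ : ∃ P : Finset (Sym2 W) ≃ Finset (Sym2 V), ∀ S (z : Sym2 V), z ∈ P S ↔ Sym2.map e z ∈ S :=
    ⟨(⟨Sym2.map e.symm, Sym2.map e, map_map_symm e, map_symm_map e⟩ : Sym2 W ≃ Sym2 V).finsetCongr,
      fun S z => by
        rw [Equiv.finsetCongr_apply, Finset.mem_map_equiv]
        exact Iff.rfl⟩
  refine ⟨fun S => μ (P S), fun S => h0 _, ?_, ?_, ?_⟩
  · rw [← h1]
    exact Fintype.sum_equiv P _ _ fun _ => rfl
  · intro S hS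
    obtain ⟨hd, hc⟩ := hs _ hS
    refine ⟨fun z hz => ?_, fun h => hc ((colorable_pull_iff e hP S 3).2 h)⟩
    have hz' : Sym2.map e.symm z ∈ P S := by
      rw [hP, map_map_symm]
      exact hz
    have h := hd _ hz'
    rwa [isDiag_map_iff] at h
  · intro 𝓐 𝓑 h𝓐 h𝓑 hN
    have memback : ∀ {𝓒 : Finset (Finset (Sym2 W))} {γ : Finset (Sym2 V)} {z : Sym2 V},
        γ ∈ 𝓒.map P.toEmbedding → z ∈ γ → P.symm γ ∈ 𝓒 ∧ Sym2.map e z ∈ P.symm γ := by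
      intro 𝓒 γ z hγ hz
      rw [Finset.mem_map_equiv] at hγ
      refine ⟨hγ, (hP _ _).1 ?_⟩
      rw [Equiv.apply_symm_apply]
      exact hz
    have key := hr (𝓐.map P.toEmbedding) (𝓑.map P.toEmbedding) ?_ ?_ ?_
    · have hrew : ∑ q ∈ (𝓐.map P.toEmbedding) ×ˢ (𝓑.map P.toEmbedding), μ (q.1 ∪ q.2)
          = ∑ q ∈ 𝓐 ×ˢ 𝓑, μ (P (q.1 ∪ q.2)) := by
        rw [Finset.sum_product, Finset.sum_product, Finset.sum_map]
        refine Finset.sum_congr rfl fun a _ => ?_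
        rw [Finset.sum_map]
        refine Finset.sum_congr rfl fun b _ => ?_
        rw [pull_union e hP]
        simp
      rw [← hrew]
      exact key
    · intro α hα z hz
      obtain ⟨hα', hz'⟩ := memback hα hz
      obtain ⟨hd, v, hv, hvB⟩ := h𝓐 _ hα' _ hz'
      refine ⟨fun h => hd ((isDiag_map_iff e z).2 h), ?_⟩
      obtain ⟨a, ha, rfl⟩ := Sym2.mem_map.1 hv
      exact ⟨a, ha, fun haB => hvB (Finset.mem_map_equiv.2 (by simpa using haB))⟩
    · intro β hβ z hz
      obtain ⟨hβ', hz'⟩ := memback hβ hz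
      obtain ⟨hd, hall⟩ := h𝓑 _ hβ' _ hz'
      refine ⟨fun h => hd ((isDiag_map_iff e z).2 h), fun v hv => ?_⟩
      have h2 := hall (e v) (Sym2.mem_map.2 ⟨v, hv, rfl⟩)
      rw [Finset.mem_map_equiv] at h2
      simpa using h2
    · intro α hα β hβ
      rw [Finset.mem_map_equiv] at hα hβ
      have hαβ : α ∪ β = P (P.symm α ∪ P.symm β) := by
        rw [pull_union e hP, Equiv.apply_symm_apply, Equiv.apply_symm_apply]
      rw [hαβ, colorable_pull_iff e hP]
      exact hN _ hα _ hβ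

end transport

end Summit.PneNP.PneNP.Theorems.AeaCutRectanglesFixedCutFooling
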